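import Summits.CriticalPhenomena.PercolationContinuityZ3.Theorems.PercNearOneGluingNoHeavyLowerTailThreePointCPISigma
import HarnessLib

/-!
# Reimer reduction of the 3-point CPI₂: `CPI₂ = [Reimer] + (★)`

Crux `stmt-CriticalPhenomena-4575`, route `PercNearOneGluingNoHeavy`, fibre line (lead memo g135 §7e,
g136; facecert memo gen 26 `FINDING-gen26-REIMER-REDUCTION.md`).  For a finite multigraph
`(V, α, ends)`, terminals `s, b` and port `c`, write for a configuration `z : α → Bool`
(`z̄ = fun a => !z a` its complement, whose open graph is the closed graph of `z`):
`Y z := c ↔ s ∨ c ↔ b` (open), `J z := s ↔ b` (open), `D z := s ↮ b in z̄` (the closed graph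
separates `s` from `b`, i.e. some `s|b` edge cut is entirely open), and
`BOX z := ∃ K, [z]_K ⊆ Y ∧ [z]_{Kᶜ} ⊆ D` (disjoint occurrence `Y □ D`, as in
`Literature.Probability.Percolation.reimer_flip_card_le`).  The 3-point counts of
`…ThreePointCPISigma` are `A₃ = #{¬J ∧ Y}` and `B₃ = #{¬J z ∧ Y z̄} = #{D ∧ Y}` (complement
bijection, `threePoint_B_eq_card_DY`), and CPI₂ is `B₃ ≤ 2 A₃`.

* `card_box_le` — **the Reimer half (unconditional)**: `#{Y □ D} ≤ A₃`.  Reimer's inequality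
  `|Y □ D| ≤ |Y ∩ D̄|` with `D̄ = {z̄ : z ∈ D} = ¬J`.
* `threePoint_cpi_two_of_star` — **the reduction**: CPI₂ follows from the one-colour inequality
  `(★)  #{Y ∧ D ∧ J ∧ ¬BOX} ≤ #{Y ∧ D ∧ ¬J ∧ BOX} + #{Y ∧ ¬J ∧ ¬D}`
  (cells `X1 ≤ X4 + X5` of the memo; exactly: `2A₃ − B₃ = (A₃ − #BOX) + (X4 + X5 − X1)`).
* `threePoint_cpi_two_of_starstar` — the same from the stronger `(★★)  #{Y ∧ D ∧ J ∧ ¬BOX} ≤ #{Y ∧ ¬J ∧ ¬D}`.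

(★)/(★★) involve ONE configuration and no complement; they hold with equality on gates and have
no counterexample among all multigraphs with `n ≤ 6` vertices and `m ≤ 9` labels (memo §2).
No definitions; statements are spelled out with `Finset.filter` in the vocabulary of
`Literature/Probability/Percolation/ComplementPatternCounts.lean`.
-/

namespace Summit.CriticalPhenomena.PercolationContinuityZ3.Theorems.ThreePointCPIReimer

open Finset Literature.Probability.Percolation

section Abstract

variable {Ω : Type*} [Fintype Ω]

/-- **Cell bookkeeping of the reduction.** For predicates `Y, J, D, BOX` on a finite type with
`BOX → Y ∧ D`, the two inequalities `#{BOX} ≤ #{¬J ∧ Y}` (Reimer) and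
`#{Y ∧ D ∧ J ∧ ¬BOX} ≤ #{Y ∧ D ∧ ¬J ∧ BOX} + #{Y ∧ ¬J ∧ ¬D}` (★) give `#{D ∧ Y} ≤ 2 · #{¬J ∧ Y}`:
with the cells `X1 = #{Y∧D∧J∧¬BOX}`, `X3 = #{Y∧D∧¬J∧¬BOX}`, `X4 = #{Y∧D∧¬J∧BOX}`, `X5 = #{Y∧¬J∧¬D}`
one has `#{D∧Y} = #BOX + X1 + X3` and `#{¬J∧Y} = X3 + X4 + X5`. [this work] -/
theorem card_le_two_mul_of_cells (Y J D BOX : Ω → Prop) [DecidablePred Y] [DecidablePred J]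
    [DecidablePred D] [DecidablePred BOX] (hBOX : ∀ z, BOX z → Y z ∧ D z)
    (hReimer : (univ.filter fun z => BOX z).card ≤ (univ.filter fun z => ¬ J z ∧ Y z).card)
    (hstar : (univ.filter fun z => Y z ∧ D z ∧ J z ∧ ¬ BOX z).card ≤
      (univ.filter fun z => Y z ∧ D z ∧ ¬ J z ∧ BOX z).card +
        (univ.filter fun z => Y z ∧ ¬ J z ∧ ¬ D z).card) :
    (univ.filter fun z => D z ∧ Y z).card ≤ 2 * (univ.filter fun z => ¬ J z ∧ Y z).card := by
  classical
  -- generic two-way split of a filter by a second predicate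
  have split2 : ∀ (P Q : Ω → Prop) [DecidablePred P] [DecidablePred Q],
      (univ.filter fun z => P z).card =
        (univ.filter fun z => P z ∧ Q z).card + (univ.filter fun z => P z ∧ ¬ Q z).card := by
    intro P Q _ _
    have h := card_filter_add_card_filter_not (s := univ.filter fun z => P z) (fun z => Q z)
    rw [filter_filter, filter_filter] at h
    exact h.symm
  -- L = #{D∧Y} = #{D∧Y∧BOX} + #{D∧Y∧¬BOX}, and #{D∧Y∧BOX} = #BOX
  have hL := split2 (fun z => D z ∧ Y z) BOX
  have hLbox : (univ.filter fun z => (D z ∧ Y z) ∧ BOX z).card = (univ.filter fun z => BOX z).card := by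
    congr 1; ext z; simp only [mem_filter, mem_univ, true_and]
    exact ⟨fun h => h.2, fun h => ⟨⟨(hBOX z h).2, (hBOX z h).1⟩, h⟩⟩
  -- #{D∧Y∧¬BOX} = X1 + X3
  have hL2 := split2 (fun z => (D z ∧ Y z) ∧ ¬ BOX z) J
  have hX1 : (univ.filter fun z => ((D z ∧ Y z) ∧ ¬ BOX z) ∧ J z).card =
      (univ.filter fun z => Y z ∧ D z ∧ J z ∧ ¬ BOX z).card := by
    congr 1; ext z; simp only [mem_filter, mem_univ, true_and]; tauto
  have hX3 : (univ.filter fun z => ((D z ∧ Y z) ∧ ¬ BOX z) ∧ ¬ J z).card =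
      (univ.filter fun z => Y z ∧ D z ∧ ¬ J z ∧ ¬ BOX z).card := by
    congr 1; ext z; simp only [mem_filter, mem_univ, true_and]; tauto
  -- A = #{¬J∧Y} = #{¬J∧Y∧D} + X5, #{¬J∧Y∧D} = X4 + X3
  have hA := split2 (fun z => ¬ J z ∧ Y z) D
  have hX5 : (univ.filter fun z => (¬ J z ∧ Y z) ∧ ¬ D z).card =
      (univ.filter fun z => Y z ∧ ¬ J z ∧ ¬ D z).card := by
    congr 1; ext z; simp only [mem_filter, mem_univ, true_and]; tauto
  have hA2 := split2 (fun z => (¬ J z ∧ Y z) ∧ D z) BOX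
  have hX4 : (univ.filter fun z => ((¬ J z ∧ Y z) ∧ D z) ∧ BOX z).card =
      (univ.filter fun z => Y z ∧ D z ∧ ¬ J z ∧ BOX z).card := by
    congr 1; ext z; simp only [mem_filter, mem_univ, true_and]; tauto
  have hX3' : (univ.filter fun z => ((¬ J z ∧ Y z) ∧ D z) ∧ ¬ BOX z).card =
      (univ.filter fun z => Y z ∧ D z ∧ ¬ J z ∧ ¬ BOX z).card := by
    congr 1; ext z; simp only [mem_filter, mem_univ, true_and]; tauto
  rw [hL, hLbox, hL2, hX1, hX3]
  rw [hA, hX5, hA2, hX4, hX3'] at hReimer ⊢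
  omega

end Abstract

/-! ### The labelled multigraph cube -/

variable {V α : Type*} [Fintype α] [DecidableEq α]

/-- Counting a predicate over configurations equals counting it over their complements
(the complement map `z ↦ z̄` is a bijection of the cube). [folklore] -/
theorem card_filter_flip (P : (α → Bool) → Prop) [DecidablePred P] :
    (univ.filter fun z : α → Bool => P (fun a => !z a)).card =
      (univ.filter fun z : α → Bool => P z).card := by
  classical
  refine Finset.card_bij' (fun z _ => fun a => !z a) (fun z _ => fun a => !z a) ?_ ?_ ?_ ?_
  · intro z hz
    simp only [mem_filter, mem_univ, true_and] at hz ⊢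
    exact hz
  · intro z hz
    simp only [mem_filter, mem_univ, true_and] at hz ⊢
    have : (fun a => !(fun a => !z a) a) = z := by funext a; simp
    rw [this]; exact hz
  · intro z _; funext a; simp
  · intro z _; funext a; simp

open Classical in
/-- **`B₃` as a one-configuration count.** The antithetic 3-point count
`B₃ = #{z : s ↮ b in z, c ↔ {s,b} in z̄}` of `…ThreePointCPISigma` equals
`#{z : s ↮ b in z̄, c ↔ {s,b} in z}` = `#{D ∧ Y}` ("an all-open `s|b` cut exists and `c ↔ T`"),
by the complement bijection. [folklore] -/
theorem threePoint_B_eq_card_DY (ends : α → Sym2 V) (s b c : V) :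
    (univ.filter fun z : α → Bool =>
        ¬ (openGraph (labelledOpen ends z)).Reachable s b ∧
        ((openGraph (labelledOpen ends fun a => !z a)).Reachable c s ∨
          (openGraph (labelledOpen ends fun a => !z a)).Reachable c b)).card =
    (univ.filter fun z : α → Bool =>
        ¬ (openGraph (labelledOpen ends fun a => !z a)).Reachable s b ∧
        ((openGraph (labelledOpen ends z)).Reachable c s ∨
          (openGraph (labelledOpen ends z)).Reachable c b)).card := by
  have h := card_filter_flip (P := fun z : α → Bool =>
        ¬ (openGraph (labelledOpen ends fun a => !z a)).Reachable s b ∧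
        ((openGraph (labelledOpen ends z)).Reachable c s ∨
          (openGraph (labelledOpen ends z)).Reachable c b))
  simpa only [Bool.not_not] using h

open Classical in
/-- **The Reimer half of CPI₂ (unconditional).** For every finite multigraph and all `s, b, c`:
`#{z : Y □ D} ≤ A₃ = #{z : s ↮ b in z, c ↔ {s,b} in z}`, where `Y □ D` is disjoint occurrence of
`Y = {c ↔ {s,b}}` and `D = {s ↮ b in z̄}` (some `K` with `[z]_K ⊆ Y` and `[z]_{Kᶜ} ⊆ D`).
Proof: Reimer's `|Y □ D| ≤ |Y ∩ D̄|` (`reimer_flip_card_le`) and `D̄ = {z̄ : z ∈ D} = {s ↮ b in z}`.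
[this work; cite: ReimerCPC2000, Thm. 1.2] -/
theorem card_box_le (ends : α → Sym2 V) (s b c : V) :
    (univ.filter fun z : α → Bool => ∃ K : Finset α,
        (∀ w : α → Bool, (∀ i ∈ K, w i = z i) →
          ((openGraph (labelledOpen ends w)).Reachable c s ∨
            (openGraph (labelledOpen ends w)).Reachable c b)) ∧
        (∀ w : α → Bool, (∀ i, i ∉ K → w i = z i) →
          ¬ (openGraph (labelledOpen ends fun a => !w a)).Reachable s b)).card ≤
    (univ.filter fun z : α → Bool =>
        ¬ (openGraph (labelledOpen ends z)).Reachable s b ∧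
        ((openGraph (labelledOpen ends z)).Reachable c s ∨
          (openGraph (labelledOpen ends z)).Reachable c b)).card := by
  classical
  set A : Finset (α → Bool) := univ.filter fun w : α → Bool =>
      (openGraph (labelledOpen ends w)).Reachable c s ∨
        (openGraph (labelledOpen ends w)).Reachable c b with hA
  set B : Finset (α → Bool) := univ.filter fun w : α → Bool =>
      ¬ (openGraph (labelledOpen ends fun a => !w a)).Reachable s b with hB
  have h := reimer_flip_card_le A B
  refine le_trans (le_of_eq ?_) (h.trans (card_le_card ?_))
  · congr 1; ext z
    simp only [hA, hB, mem_filter, mem_univ, true_and]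
  · intro z hz
    rw [mem_inter] at hz
    obtain ⟨hzA, hzB⟩ := hz
    simp only [hA, mem_filter, mem_univ, true_and] at hzA
    obtain ⟨x, hx, hxz⟩ := mem_image.1 hzB
    simp only [hB, mem_filter, mem_univ, true_and] at hx
    have hxz' : (fun a => !x a) = z := hxz
    rw [hxz'] at hx
    simp only [mem_filter, mem_univ, true_and]
    exact ⟨hx, hzA⟩

open Classical in
/-- **The reduction `CPI₂ ⟸ (★)`.** For every finite multigraph `(V, α, ends)` and `s, b, c`: if
`(★)  #{Y ∧ D ∧ J ∧ ¬(Y □ D)} ≤ #{Y ∧ D ∧ ¬J ∧ (Y □ D)} + #{Y ∧ ¬J ∧ ¬D}`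
(`Y = c ↔ {s,b}`, `J = s ↔ b` in `z`; `D = s ↮ b in z̄`; `Y □ D` disjoint occurrence), then the
3-point CPI₂ `B₃ ≤ 2 A₃` holds, i.e.
`#{z : s ↮ b in z, c ↔ {s,b} in z̄} ≤ 2 · #{z : s ↮ b in z, c ↔ {s,b} in z}`.
Proof: `B₃ = #{D ∧ Y}` (complement bijection), the Reimer half `#{Y □ D} ≤ A₃`, and the cell
bookkeeping `card_le_two_mul_of_cells`. [this work] -/
theorem threePoint_cpi_two_of_star (ends : α → Sym2 V) (s b c : V)
    (hstar : (univ.filter fun z : α → Bool =>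
        ((openGraph (labelledOpen ends z)).Reachable c s ∨
          (openGraph (labelledOpen ends z)).Reachable c b) ∧
        ¬ (openGraph (labelledOpen ends fun a => !z a)).Reachable s b ∧
        (openGraph (labelledOpen ends z)).Reachable s b ∧
        ¬ (∃ K : Finset α,
          (∀ w : α → Bool, (∀ i ∈ K, w i = z i) →
            ((openGraph (labelledOpen ends w)).Reachable c s ∨
              (openGraph (labelledOpen ends w)).Reachable c b)) ∧
          (∀ w : α → Bool, (∀ i, i ∉ K → w i = z i) →
            ¬ (openGraph (labelledOpen ends fun a => !w a)).Reachable s b))).card ≤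
      (univ.filter fun z : α → Bool =>
        ((openGraph (labelledOpen ends z)).Reachable c s ∨
          (openGraph (labelledOpen ends z)).Reachable c b) ∧
        ¬ (openGraph (labelledOpen ends fun a => !z a)).Reachable s b ∧
        ¬ (openGraph (labelledOpen ends z)).Reachable s b ∧
        (∃ K : Finset α,
          (∀ w : α → Bool, (∀ i ∈ K, w i = z i) →
            ((openGraph (labelledOpen ends w)).Reachable c s ∨
              (openGraph (labelledOpen ends w)).Reachable c b)) ∧
          (∀ w : α → Bool, (∀ i, i ∉ K → w i = z i) →
            ¬ (openGraph (labelledOpen ends fun a => !w a)).Reachable s b))).card +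
      (univ.filter fun z : α → Bool =>
        ((openGraph (labelledOpen ends z)).Reachable c s ∨
          (openGraph (labelledOpen ends z)).Reachable c b) ∧
        ¬ (openGraph (labelledOpen ends z)).Reachable s b ∧
        ¬ ¬ (openGraph (labelledOpen ends fun a => !z a)).Reachable s b).card) :
    (univ.filter fun z : α → Bool =>
        ¬ (openGraph (labelledOpen ends z)).Reachable s b ∧
        ((openGraph (labelledOpen ends fun a => !z a)).Reachable c s ∨
          (openGraph (labelledOpen ends fun a => !z a)).Reachable c b)).card ≤
      2 * (univ.filter fun z : α → Bool =>
        ¬ (openGraph (labelledOpen ends z)).Reachable s b ∧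
        ((openGraph (labelledOpen ends z)).Reachable c s ∨
          (openGraph (labelledOpen ends z)).Reachable c b)).card := by
  classical
  rw [threePoint_B_eq_card_DY ends s b c]
  -- the four predicates
  set Y : (α → Bool) → Prop := fun z => (openGraph (labelledOpen ends z)).Reachable c s ∨
      (openGraph (labelledOpen ends z)).Reachable c b with hY
  set J : (α → Bool) → Prop := fun z => (openGraph (labelledOpen ends z)).Reachable s b with hJ
  set D : (α → Bool) → Prop := fun z =>
      ¬ (openGraph (labelledOpen ends fun a => !z a)).Reachable s b with hD
  set BOX : (α → Bool) → Prop := fun z => ∃ K : Finset α,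
      (∀ w : α → Bool, (∀ i ∈ K, w i = z i) → Y w) ∧
      (∀ w : α → Bool, (∀ i, i ∉ K → w i = z i) → D w) with hBOXdef
  have hBOX : ∀ z, BOX z → Y z ∧ D z := by
    rintro z ⟨K, h1, h2⟩
    exact ⟨h1 z fun i _ => rfl, h2 z fun i _ => rfl⟩
  have hReimer : (univ.filter fun z => BOX z).card ≤ (univ.filter fun z => ¬ J z ∧ Y z).card :=
    card_box_le ends s b c
  exact card_le_two_mul_of_cells Y J D BOX hBOX hReimer hstar

open Classical in
/-- **`CPI₂ ⟸ (★★)`.** The stronger one-colour inequality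
`(★★)  #{Y ∧ D ∧ J ∧ ¬(Y □ D)} ≤ #{Y ∧ ¬J ∧ ¬D}`
(inside `{c ↔ s ↔ b open, s ↮ b closed}`, "not disjointly" is rarer than
`{c ↔ exactly one terminal open, s ↔ b closed}`) also implies the 3-point CPI₂. [this work] -/
theorem threePoint_cpi_two_of_starstar (ends : α → Sym2 V) (s b c : V)
    (hss : (univ.filter fun z : α → Bool =>
        ((openGraph (labelledOpen ends z)).Reachable c s ∨
          (openGraph (labelledOpen ends z)).Reachable c b) ∧
        ¬ (openGraph (labelledOpen ends fun a => !z a)).Reachable s b ∧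
        (openGraph (labelledOpen ends z)).Reachable s b ∧
        ¬ (∃ K : Finset α,
          (∀ w : α → Bool, (∀ i ∈ K, w i = z i) →
            ((openGraph (labelledOpen ends w)).Reachable c s ∨
              (openGraph (labelledOpen ends w)).Reachable c b)) ∧
          (∀ w : α → Bool, (∀ i, i ∉ K → w i = z i) →
            ¬ (openGraph (labelledOpen ends fun a => !w a)).Reachable s b))).card ≤
      (univ.filter fun z : α → Bool =>
        ((openGraph (labelledOpen ends z)).Reachable c s ∨
          (openGraph (labelledOpen ends z)).Reachable c b) ∧
        ¬ (openGraph (labelledOpen ends z)).Reachable s b ∧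
        ¬ ¬ (openGraph (labelledOpen ends fun a => !z a)).Reachable s b).card) :
    (univ.filter fun z : α → Bool =>
        ¬ (openGraph (labelledOpen ends z)).Reachable s b ∧
        ((openGraph (labelledOpen ends fun a => !z a)).Reachable c s ∨
          (openGraph (labelledOpen ends fun a => !z a)).Reachable c b)).card ≤
      2 * (univ.filter fun z : α → Bool =>
        ¬ (openGraph (labelledOpen ends z)).Reachable s b ∧
        ((openGraph (labelledOpen ends z)).Reachable c s ∨
          (openGraph (labelledOpen ends z)).Reachable c b)).card := by
  refine threePoint_cpi_two_of_star ends s b c (hss.trans ?_)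
  exact Nat.le_add_left _ _

end Summit.CriticalPhenomena.PercolationContinuityZ3.Theorems.ThreePointCPIReimer
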